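import Summits.Parity.GeneralizedHardyLittlewood.Theorems.LeeYangFibresRelativeDimOneMoebiusSplitDefs
import Literature.NumberTheory.Sieve.LinearEquationsInPrimesDimOne
import HarnessLib

/-!
# Route `LeeYangFibres`, crux `RelativeDimOne` (stmt-Parity-14113), line `single-moebius-split`:
# vocabulary of the reshaped stubs (lead c7, cycle 2)

Second route-posited vocabulary file of the line (the first, `…MoebiusSplitDefs`, is full). NOTHING
IS ASSERTED: every `def … : Prop` below is the type (or a component of the type) of a registered stub of
the checked skeleton `Cruxes/RelativeDimOne/Lines/single_moebius_split.lean`, reshaped after wave 1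
(`stub_truncLatticeCount` p139091 and `stub_assembly` p138577 landed; T1b and S1 are split):

* T1b `TruncSingularSeriesAsymp (k+1)` ⟸ `stub_tssCompose : (∀ t, TSSInduction t) → (∀ t, TSSLocalData t)
  → ∀ k, TruncSingularSeriesAsymp (k+1)` from
  - `stub_tssInduction : ∀ t, TSSInduction t` — the `t`-variable Goldston–Yıldırım sum with GENERAL local
    data given by windows `W_p ⊆ {0,…,p−1}` and root sets `Z_{p,i}` (`|Z_{p,i}| ≤ 1` at unconditioned primes):
    `g_p(S) = #{r ∈ W_p : r ∈ Z_{p,i} ∀ i ∈ S}/p` (`gyWeight`), summed as `gySum R g y`, is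
    `∏_{p<y} β_p + (error)`, `β_p = (p/(p−1))^t #{r ∈ W_p : r ∉ Z_{p,i} ∀ i}/p` (`gyLocalFactor`), by
    induction on `t` along the LAST variable (`tss_gy_peel`, p140321) with the one-variable lemma with
    frozen primes (`tss_ovl`, p140502) — the class of data is closed under the conditioning
    `W_p ↦ W_p ∩ Z_{p,t}` at the primes of the peeled variable;
  - `stub_tssLocalData : ∀ t, TSSLocalData t` — for square-free tuples `d`, `ρ_Ψ(d)/∏ d_i =
    ∏_{p<y} g^Ψ_p({i : p ∣ d_i})` with the root sets `rootSet Ψ p i = {r mod p : p ∣ ψ_i(r)}` and full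
    windows (Chinese remainder theorem; tree `localDensity_mul`, `localDensity_primeModuli`).
* S1 `TermBound k j η` ⟸ (skeleton, `ε/2 + ε/2`) from
  - `stub_termExpansion : ∀ k j, j ≠ 0 → TermExpansionBound k j` — opening the von Mangoldt factor `j`
    and the truncated factors `i > j`: `|telescopeTermSum … j| ≤ N^{1/2} + (log N)^k ∑_e ∑_d |Σ(d,e)|`
    with the single-Möbius CLASS SUMS `Σ(d,e) = termClassSum Ψ K N R_j j d e`;
  - `stub_termClassSums : ∀ k j, j ≠ 0 → ∀ η > 0, (∀ C A, HybridOneMoebius j η C A) → TermClassSumBound k j η`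
    — each class sum is a single-Möbius hybrid sum along one progression (the atom), summed over `(d, e)`.

References: D. A. Goldston, C. Y. Yıldırım, Integers 3 (2003) A5 = arXiv:math/0111212, Lemma 2.1, §2–3
[GoldstonYildirim2001]; B. Green, T. Tao, Ann. of Math. 171 (2010), App. D [GreenTao2010]; W. Sawin,
M. Shusterman, arXiv:1808.04001, Cor. 6.1 [SawinShusterman2018].
-/

noncomputable section

open scoped BigOperators Classical
open Filter Finset Literature.NumberTheory.Sieve

namespace Summit.Parity.GeneralizedHardyLittlewood.Cruxes.RelativeDimOne.SingleMoebiusSplit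

/-! ## T1b: the `t`-variable Goldston–Yıldırım sum with general local data -/

section GY

variable {t : ℕ}

/-- Local data from a window `W_p` and root sets `Z_{p,i}`:
`g_p(S) = #{r ∈ W_p : r ∈ Z_{p,i} for all i ∈ S} / p` (so `g_p(∅) = |W_p|/p`, `= 1` for a full window). -/
def gyWeight (W : ℕ → Finset ℕ) (Z : ℕ → Fin t → Finset ℕ) (p : ℕ) (S : Finset (Fin t)) : ℝ :=
  ((((W p).filter fun r => ∀ i ∈ S, r ∈ Z p i).card : ℕ) : ℝ) / p

/-- The expected local factor of the data `(W, Z)` at `p`: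
`β_p = (p/(p−1))^t · #{r ∈ W_p : r ∉ Z_{p,i} for all i} / p` (for the root data of a `d = 1` system with
full window this is Green–Tao's `localFactor Ψ p`). -/
def gyLocalFactor (W : ℕ → Finset ℕ) (Z : ℕ → Fin t → Finset ℕ) (p : ℕ) : ℝ :=
  ((p : ℝ) / ((p : ℝ) - 1)) ^ t * (((((W p).filter fun r => ∀ i, r ∉ Z p i).card : ℕ) : ℝ) / p)

/-- The `t`-variable Goldston–Yıldırım sum with local data `g` read prime by prime below `y`:
`GY_t(R, g; y) = ∑_{1 ≤ d_i ≤ R_i} (∏_i μ(d_i) log(R_i/d_i)) ∏_{p<y} g_p({i : p ∣ d_i})`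
(the left-hand side of `tss_gy_peel`). -/
def gySum (R : Fin t → ℝ) (g : ℕ → Finset (Fin t) → ℝ) (y : ℕ) : ℝ :=
  ∑ d ∈ Fintype.piFinset (fun i : Fin t => Finset.Icc 1 ⌊R i⌋₊),
    (∏ i, ((ArithmeticFunction.moebius (d i) : ℤ) : ℝ) * Real.log (R i / d i)) *
      ∏ p ∈ Nat.primesBelow y, g p (Finset.univ.filter fun i => p ∣ d i)

/-- The root set of the form `ψ_i` modulo `p`: `{r ∈ {0, …, p−1} : p ∣ ψ_i(r)}` (one point if `p ∤ ψ̇_i`). -/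
def rootSet (Ψ : Fin t → AffLinForm 1) (p : ℕ) (i : Fin t) : Finset ℕ :=
  (Finset.range p).filter fun r => (p : ℤ) ∣ (Ψ i).eval fun _ => (r : ℤ)

end GY

/-- **T1b-A — the induction on the number of variables (general local data).** For every `t` there are
`c > 0`, `m`, `κ ≥ 1` and, for every `B ≥ 0`, a constant `C` such that: for windows `W`, root sets `Z`,
finite sets of primes `P` (FROZEN: arbitrary window, e.g. the primes of the already-peeled variables and the
small primes) and `Q` (ROUGH: full window, at most one root per form, but no genericity), levels
`R_i ∈ [Rmin, Rmax]`, `Rmin ≥ 8`, a cut-off `y` above all levels and all of `P`, such that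
* off `P` the window is full, `p > 2t`, and every `Z_{p,i}` has at most one element;
* off `P ∪ Q` the prime is GENERIC: the `Z_{p,i}` are singletons `{r_i}`, `r_i < p`, pairwise distinct;
* the levels are staggered against the frozen primes: `(∏_{p∈P} p)³ (∏_{j>i} R_j)³ ≤ R_i²` for every `i`;
* `|Q| ≤ B log Rmin`;
one has `|GY_t(R, g_{W,Z}; y) − ∏_{p<y} β_p(W,Z)| ≤
  C κ^{|P|} (∏_{p∈Q} (p/(p−1))^t) (∏_{p∈P} |W_p|/p) (log Rmax)^m e^{−c√(log Rmin)}`.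
(Induction on `t` along the last variable: `tss_gy_peel`; the main terms by `tss_ovl` with frozen set `P`,
twist `w(p) = A_p/B_p` where `B_p`, `A_p` are the `β`'s of the data restricted to the first `t` indices with
window `W_p` resp. `W_p ∩ Z_{p,t}` — generic `p w(p) = p/(p−t)`, rough `|p w(p)| ≤ 2` — after dividing by
`∏_{p<y, p∉P} B_p` (`|·| ≤ ∏_{p∈Q}(p/(p−1))^t` by Bernoulli); the inner errors summed over the peeled
variable `x` with `∏_{p∣x, p∉P} 1/p ≤ gcd(x, ∏P)/x` and `∑_{x≤R} τ(x)^j/x ≤ (1 + log R)^{2^j}`.) -/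
def TSSInduction (t : ℕ) : Prop :=
  ∃ c : ℝ, 0 < c ∧ ∃ m : ℕ, ∃ κ : ℝ, 1 ≤ κ ∧ ∀ B : ℝ, 0 ≤ B → ∃ C : ℝ, 0 ≤ C ∧
    ∀ (W : ℕ → Finset ℕ) (Z : ℕ → Fin t → Finset ℕ) (P Q : Finset ℕ) (R : Fin t → ℝ)
      (Rmin Rmax : ℝ) (y : ℕ),
      (∀ p ∈ P, p.Prime) → (∀ p ∈ Q, p.Prime) →
      (∀ p ∈ P, W p ⊆ Finset.range p) →
      (∀ p : ℕ, p.Prime → p ∉ P → W p = Finset.range p ∧ 2 * t < p ∧ ∀ i, (Z p i).card ≤ 1) →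
      (∀ p : ℕ, p.Prime → p ∉ P → p ∉ Q →
        ∀ i : Fin t, ∃ r : ℕ, r < p ∧ Z p i = {r} ∧ ∀ j : Fin t, j ≠ i → r ∉ Z p j) →
      8 ≤ Rmin → (∀ i, Rmin ≤ R i ∧ R i ≤ Rmax) →
      (∀ i, ⌊R i⌋₊ < y) → (∀ p ∈ P, p < y) →
      (∀ i : Fin t, (∏ p ∈ P, (p : ℝ)) ^ 3 * (∏ j ∈ Finset.Ioi i, R j) ^ 3 ≤ R i ^ 2) →
      (Q.card : ℝ) ≤ B * Real.log Rmin →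
        |gySum R (gyWeight W Z) y - ∏ p ∈ Nat.primesBelow y, gyLocalFactor W Z p| ≤
          C * κ ^ P.card * (∏ p ∈ Q, ((p : ℝ) / ((p : ℝ) - 1)) ^ t) *
            (∏ p ∈ P, (((W p).card : ℝ) / p)) * Real.log Rmax ^ m *
              Real.exp (-(c * Real.sqrt (Real.log Rmin)))

/-- **T1b-B — the local data of a `d = 1` system (Chinese remainder theorem).** For a tuple `d` of
square-free positive integers below `y`, `ρ_Ψ(d)/∏_i d_i = ∏_{p<y} g^Ψ_p({i : p ∣ d_i})` with the root data
`g^Ψ_p(S) = #{r mod p : p ∣ ψ_i(r) ∀ i ∈ S}/p` (full windows): `solCount` counts `n mod ∏ d_i`, the condition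
`d_i ∣ ψ_i(n)` is `p ∣ ψ_i(n)` for the primes `p ∣ d_i`, and modulo `p^{e_p}` exactly `p^{e_p−1} · #{r mod p : …}`
residues qualify (tree: `localDensity`, `localDensity_mul`, `localDensity_primeModuli`, `primeDensity_eq_card`). -/
def TSSLocalData (t : ℕ) : Prop :=
  ∀ (Ψ : Fin t → AffLinForm 1) (d : Fin t → ℕ) (y : ℕ),
    (∀ i, 0 < d i) → (∀ i, Squarefree (d i)) → (∀ i, d i < y) →
      (solCount Ψ d : ℝ) / (∏ i, (d i : ℝ)) =
        ∏ p ∈ Nat.primesBelow y,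
          gyWeight (fun p => Finset.range p) (rootSet Ψ) p (Finset.univ.filter fun i => p ∣ d i)

/-! ## S1: term `j ≥ 1` — the single-Möbius class sums -/

/-- **The single-Möbius class sum `Σ(d, e)`** of term `j`: over the `n ∈ [−N, N]` with `(n) ∈ K`, all
`ψ_i(n) > 0`, `d_i ∣ ψ_i(n)` for `i > j`, `e ∣ ψ_j(n)` and `ψ_j(n) > R_j e` (so the Möbius variable
`ψ_j(n)/e` exceeds `R_j`), the sum of `μ(ψ_j(n)/e) · log(ψ_j(n)/(e R_j)) · ∏_{i<j} Λ(ψ_i(n))` — a Möbius sum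
along ONE progression (the class of `n` cut out by the divisibilities) against `j` von Mangoldt factors,
with a monotone weight: the input shape of the atom `HybridOneMoebius j`. -/
def termClassSum {k : ℕ} (Ψ : Fin (k + 1) → AffLinForm 1) (K : Set (Fin 1 → ℝ)) (N : ℕ) (Rj : ℝ)
    (j : Fin (k + 1)) (d : Fin (k + 1) → ℕ) (e : ℕ) : ℝ :=
  ∑ n ∈ (Finset.Icc (-(N : ℤ)) N).filter (fun n : ℤ =>
      (fun _ : Fin 1 => (n : ℝ)) ∈ K ∧ (∀ i, 0 < (Ψ i).eval (fun _ => n)) ∧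
      (∀ i ∈ Finset.Ioi j, ((d i : ℕ) : ℤ) ∣ (Ψ i).eval (fun _ => n)) ∧
      (e : ℤ) ∣ (Ψ j).eval (fun _ => n) ∧ Rj * e < (((Ψ j).eval (fun _ => n) : ℤ) : ℝ)),
    (ArithmeticFunction.moebius (((Ψ j).eval (fun _ => n)) / (e : ℤ)).toNat : ℝ) *
      Real.log ((((Ψ j).eval (fun _ => n) : ℤ) : ℝ) / ((e : ℝ) * Rj)) *
        ∏ i ∈ Finset.Iio j, intVonMangoldt ((Ψ i).eval (fun _ => n))

/-- **S1-D — the expansion of term `j`.** For levels `R_i = N^{δ_i}` (`δ_i > 0`, `∑ δ_i ≤ 1/4`) and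
`N ≥ N₀(k, L, δ)`: `|telescopeTermSum Ψ K N R j| ≤ N^{1/2} + (log N)^k ∑_{e ≤ 2LN} ∑_d |Σ(d, e)|`, the inner
sum over tuples `d` with `1 ≤ d_i ≤ ⌊R_i⌋` for `i > j` and `d_i = 1` for `i ≤ j` (the shape of
`prod_Ioi_lambdaR_eq_sum`). Content: the summand of term `j` vanishes unless every `ψ_i(n) ≥ 1`; the single
`n` with `ψ_j(n) = 1` costs `≤ log^k(2LN) · log N · N^{1/4} log^k N ≤ N^{1/2}`; for `ψ_j(n) ≥ 2` open
`(Λ − Λ_{R_j})(ψ_j(n))` (`termBound_aux_vonMangoldt_sub_lambdaR`, `E = 2LN`) and the truncated factors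
(`prod_Ioi_lambdaR_eq_sum`), swap the sums, and bound `|∏_{i>j} μ(d_i) log(R_i/d_i)| ≤ (log N)^k`. -/
def TermExpansionBound (k : ℕ) (j : Fin (k + 1)) : Prop :=
  ∀ L : ℕ, ∀ δ : Fin (k + 1) → ℝ, (∀ i, 0 < δ i) → (∑ i, δ i) ≤ 1 / 4 →
    ∃ N₀ : ℕ, ∀ N : ℕ, N₀ ≤ N → ∀ Ψ : Fin (k + 1) → AffLinForm 1,
      IsNondegenerateSystem Ψ → affLinSize Ψ N ≤ L →
      ∀ K : Set (Fin 1 → ℝ), Convex ℝ K → K ⊆ realBox 1 N →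
        |telescopeTermSum Ψ K N (fun i => (N : ℝ) ^ (δ i)) j| ≤
          (N : ℝ) ^ (1 / 2 : ℝ) + Real.log N ^ k *
            ∑ e ∈ Finset.Icc 1 (2 * L * N),
              ∑ d ∈ Fintype.piFinset (fun i : Fin (k + 1) =>
                  if i ∈ Finset.Ioi j then Finset.Icc 1 ⌊(N : ℝ) ^ (δ i)⌋₊ else {1}),
                |termClassSum Ψ K N ((N : ℝ) ^ (δ j)) j d e|

/-- **S1-E — the class sums are negligible given the atom** (conclusion; the registered stub is
`j ≠ 0 → 0 < η → (∀ C A, HybridOneMoebius j η C A) → TermClassSumBound k j η`). For levels staggered by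
`2 + 1/η` and `N ≥ N₀`: `(log N)^k ∑_{e ≤ 2LN} ∑_d |Σ(d, e)| ≤ ε N`. Content (Sawin–Shusterman Cor. 6.1 over
`ℤ`): `Σ(d,e) = 0` unless `e ≤ 2LN/R_j`; the `n` of a class sum form one residue class `n₀ (mod M₀)`
(`termBound_aux_residue_class`), `n = n₀ + M₀ m`, along which `ψ_j(n)/e = φ₀(m)` is a form of modulus
`|ψ̇_j| M₀/e ≤ L ∏_{i>j} d_i ≤ L N^{σ_j}` (`σ_j = ∑_{i>j} δ_i`) while the range of `m` has length
`Y ≍ N/M₀ ≥ N^{δ_j − σ_j}/L`, so `φ₀` is `Y^{η}`-dilated by the staggering; the forms `φ_i(m) = ψ_i(n₀ + M₀ m)`,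
`i < j`, are `Y^{C(δ)}`-dilated with shifts `≤ L · |φ̇_i| Y`, and `(φ₀; φ_i)` is non-degenerate because `Ψ` is;
Abel summation of the monotone weight (`termBound_aux_abel_atom`) and the atom on every initial segment give
`|Σ(d,e)| ≤ 2 log(2LN) (2Y 𝔖(φ) + Y)/(log Y)^A`, `𝔖(φ) ≤ (C log N)^j` (`termBound_aux_singularProduct_le`);
finally `∑_{(d,e)} 1/M₀ ≪ L^{k+1} (log N)^{2^{k+1}}` (`sum_inv_moduli_le`) and `A` large. -/
def TermClassSumBound (k : ℕ) (j : Fin (k + 1)) (η : ℝ) : Prop :=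
  ∀ L : ℕ, ∀ δ : Fin (k + 1) → ℝ, (∀ i, 0 < δ i) → StaggeredBy (2 + 1 / η) δ → (∑ i, δ i) ≤ 1 / 4 →
    ∀ ε : ℝ, 0 < ε → ∃ N₀ : ℕ, ∀ N : ℕ, N₀ ≤ N → ∀ Ψ : Fin (k + 1) → AffLinForm 1,
      IsNondegenerateSystem Ψ → affLinSize Ψ N ≤ L →
      ∀ K : Set (Fin 1 → ℝ), Convex ℝ K → K ⊆ realBox 1 N →
        Real.log N ^ k *
            ∑ e ∈ Finset.Icc 1 (2 * L * N),
              ∑ d ∈ Fintype.piFinset (fun i : Fin (k + 1) =>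
                  if i ∈ Finset.Ioi j then Finset.Icc 1 ⌊(N : ℝ) ^ (δ i)⌋₊ else {1}),
                |termClassSum Ψ K N ((N : ℝ) ^ (δ j)) j d e| ≤ ε * N

/-! ## Sanity lemmas (real proofs) -/

/-- With a full window, `g_p(∅) = 1` (the data is normalised: primes dividing no variable contribute nothing). -/
theorem gyWeight_empty_of_range {t : ℕ} (Z : ℕ → Fin t → Finset ℕ) {p : ℕ} (hp : 0 < p) :
    gyWeight (fun q => Finset.range q) Z p ∅ = 1 := by
  unfold gyWeight
  have : ((Finset.range p).filter fun r => ∀ i ∈ (∅ : Finset (Fin t)), r ∈ Z p i) = Finset.range p :=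
    Finset.filter_true_of_mem fun r _ i hi => absurd hi (Finset.notMem_empty i)
  rw [this, Finset.card_range]
  have hp' : (p : ℝ) ≠ 0 := by exact_mod_cast hp.ne'
  exact div_self hp'

/-- Root sets have at most one element at primes not dividing the leading coefficient
(`a r + b ≡ 0 (mod p)` has the unique solution `r ≡ −b a⁻¹`). Registered sub-goal of the line (the
vocabulary file rides on it). -/
theorem card_rootSet_le_one : ∀ (t : ℕ) (Ψ : Fin t → AffLinForm 1) (p : ℕ), p.Prime →
    ∀ i : Fin t, ¬ ((p : ℤ) ∣ (Ψ i).coeff 0) → (rootSet Ψ p i).card ≤ 1 := by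
  intro t Ψ p hp i ha
  refine Finset.card_le_one.mpr fun r hr r' hr' => ?_
  rw [rootSet, Finset.mem_filter, Finset.mem_range] at hr hr'
  obtain ⟨hr, hdr⟩ := hr
  obtain ⟨hr', hdr'⟩ := hr'
  rw [DimOne.eval_eq] at hdr hdr'
  have hsub : (p : ℤ) ∣ (Ψ i).coeff 0 * ((r : ℤ) - (r' : ℤ)) := by
    have h := dvd_sub hdr hdr'
    have e : (Ψ i).coeff 0 * (r : ℤ) + (Ψ i).const - ((Ψ i).coeff 0 * (r' : ℤ) + (Ψ i).const) =
        (Ψ i).coeff 0 * ((r : ℤ) - (r' : ℤ)) := by ring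
    rwa [e] at h
  rcases (Nat.prime_iff_prime_int.mp hp).dvd_or_dvd hsub with h | h
  · exact absurd h ha
  · have h1 : (r : ℤ) < p := by exact_mod_cast hr
    have h2 : (r' : ℤ) < p := by exact_mod_cast hr'
    have h3 : (0 : ℤ) ≤ r := by positivity
    have h4 : (0 : ℤ) ≤ r' := by positivity
    obtain ⟨q, hq⟩ := h
    have hq0 : q = 0 := by
      by_contra hne
      rcases lt_or_gt_of_ne hne with hlt | hgt
      · have : q ≤ -1 := by omega
        nlinarith
      · have : 1 ≤ q := by omega
        nlinarith
    have : (r : ℤ) = r' := by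
      have h5 : (r : ℤ) - r' = 0 := by rw [hq, hq0, mul_zero]
      linarith
    exact_mod_cast this

end Summit.Parity.GeneralizedHardyLittlewood.Cruxes.RelativeDimOne.SingleMoebiusSplit
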